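import Summits.ResolutionOfSingularities.ResolutionOfSingularities.Theorems.FrobeniusLadderFRationalResolutionLogClosedStratumPoint
import HarnessLib

/-!
# Crux `FrobeniusLadder.FRationalResolution` (stmt-ResolutionOfSingularities-15317), line `redirect`,
# stub `stub_diagonalizableQuotientResolution` — **regularity test at a full-rank point of a log
# regular scheme: regular iff Kato's ideal needs exactly `rank` generators** (brick P3' of the
# point-blow-up recursion for the surface case, memo MEMO-15317-leafhand2-g6 §3)

Continuation of `…LogClosedStratumPoint` (at a point of a log regular scheme whose stratum is
zero-dimensional, Kato's ideal `I(φ) = φ(P ∖ F)·R` IS the maximal ideal). Since a Noetherian local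
ring is regular iff its maximal ideal is generated by `dim R` elements (Mathlib
`isRegularLocalRing_iff`, `Submodule.spanFinrank`), and `dim R` is the rank term `n − rk Fᵍᵖ` at
such a point, we get the termination test of the recursion in Kato's currency:

  **at a full-rank point, `R` is regular ⟺ `μ(I(φ)) = n − rk Fᵍᵖ`** (`μ` = minimal number of
  generators), and in any case `n − rk Fᵍᵖ ≤ μ(I(φ))`;

so a SINGULAR full-rank point is one where the monoid ideal `P ∖ F` needs more than `rank`
generators in `R` (for a sharp saturated rank-`2` chart: a Hilbert basis with `≥ 3` elements).
Local-ring chart forms (`LogChart.IsLogRegularLocal`) and `A_𝔭` forms (`LogChart.IsLogRegularAt`).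

References: [Kato1994] Def. (2.1), (10.4) last step; [Matsumura1987] §14 (regular local rings).
Folklore bookkeeping; no new definitions, no named facts, no sorry.
-/

noncomputable section

-- single-problem summit: the doubled namespace component is forced
set_option linter.dupNamespace false

open IsLocalRing
open Literature.AlgebraicGeometry.Resolution

namespace Summit.ResolutionOfSingularities.ResolutionOfSingularities.Theorems.FRationalResolution.LogClosedStratumPointRegular

universe u

/-! ## Generic: regularity of a Noetherian local ring of given dimension -/

/-- For a Noetherian local ring whose dimension is the natural number `r`: `R` is regular iff its
maximal ideal is generated by `r` elements (`μ(𝔪) = r`). [cite: Matsumura1987, §14] -/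
theorem isRegularLocalRing_iff_spanFinrank_eq {R : Type u} [CommRing R] [IsLocalRing R]
    [IsNoetherianRing R] {r : ℕ} (hdim : ringKrullDim R = (r : WithBot ℕ∞)) :
    IsRegularLocalRing R ↔ (maximalIdeal R).spanFinrank = r := by
  rw [isRegularLocalRing_iff, hdim]
  constructor
  · intro h; exact_mod_cast h
  · intro h; exact_mod_cast h

/-- For a Noetherian local ring whose dimension is the natural number `r`, the maximal ideal
needs at least `r` generators (`r ≤ μ(𝔪)`, Krull's height theorem as packaged in Mathlib's
`ringKrullDim_le_spanFinrank_maximalIdeal`). [cite: Matsumura1987, Thm. 13.4] -/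
theorem le_spanFinrank_maximalIdeal_of_ringKrullDim_eq {R : Type u} [CommRing R] [IsLocalRing R]
    [IsNoetherianRing R] {r : ℕ} (hdim : ringKrullDim R = (r : WithBot ℕ∞)) :
    r ≤ (maximalIdeal R).spanFinrank := by
  have h := ringKrullDim_le_spanFinrank_maximalIdeal R
  rw [hdim] at h
  exact_mod_cast h

/-! ## Chart through a local ring (`LogChart.IsLogRegularLocal`) -/

section Local

variable {n : ℕ} {R : Type u} [CommRing R] [IsLocalRing R] [IsNoetherianRing R]

/-- **Regularity test at a full-rank point.** Let `φ : P → R` be a chart through a Noetherian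
local ring satisfying Kato's condition (2.1) with `dim R` equal to the rank term
`r = n − rk Fᵍᵖ`. Then `R` is a regular local ring iff Kato's ideal `I(φ) = φ(P ∖ F)·R` (which is
the maximal ideal, `…LogClosedStratumPoint`) is generated by `r` elements.
[cite: Kato1994, Def. (2.1) and (10.4)] -/
theorem isRegularLocalRing_iff_spanFinrank_nonunitIdeal_eq
    (P : AddSubmonoid (Fin n → ℤ)) (φ : Multiplicative P →* R)
    (hreg : LogChart.IsLogRegularLocal P φ)
    (hdim : ringKrullDim R = ((n - Module.finrank ℤ
      (Submodule.span ℤ ((fun p : P => (p : Fin n → ℤ)) '' LogChart.unitFace P φ)) : ℕ) : WithBot ℕ∞)) :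
    IsRegularLocalRing R ↔ (LogChart.nonunitIdeal P φ).spanFinrank = n - Module.finrank ℤ
      (Submodule.span ℤ ((fun p : P => (p : Fin n → ℤ)) '' LogChart.unitFace P φ)) := by
  rw [LogClosedStratumPoint.nonunitIdeal_eq_maximalIdeal_of_ringKrullDim_eq_rank P φ hreg hdim]
  exact isRegularLocalRing_iff_spanFinrank_eq hdim

/-- At a full-rank point Kato's ideal needs at least `rank` generators. [cite: Kato1994, Def. (2.1)] -/
theorem rank_le_spanFinrank_nonunitIdeal
    (P : AddSubmonoid (Fin n → ℤ)) (φ : Multiplicative P →* R)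
    (hreg : LogChart.IsLogRegularLocal P φ)
    (hdim : ringKrullDim R = ((n - Module.finrank ℤ
      (Submodule.span ℤ ((fun p : P => (p : Fin n → ℤ)) '' LogChart.unitFace P φ)) : ℕ) : WithBot ℕ∞)) :
    n - Module.finrank ℤ
      (Submodule.span ℤ ((fun p : P => (p : Fin n → ℤ)) '' LogChart.unitFace P φ)) ≤
        (LogChart.nonunitIdeal P φ).spanFinrank := by
  rw [LogClosedStratumPoint.nonunitIdeal_eq_maximalIdeal_of_ringKrullDim_eq_rank P φ hreg hdim]
  exact le_spanFinrank_maximalIdeal_of_ringKrullDim_eq hdim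

/-- **A SINGULAR full-rank point is one where Kato's ideal needs MORE than `rank` generators.**
[cite: Kato1994, Def. (2.1) and (10.4)] -/
theorem rank_lt_spanFinrank_nonunitIdeal_of_not_isRegularLocalRing
    (P : AddSubmonoid (Fin n → ℤ)) (φ : Multiplicative P →* R)
    (hreg : LogChart.IsLogRegularLocal P φ)
    (hdim : ringKrullDim R = ((n - Module.finrank ℤ
      (Submodule.span ℤ ((fun p : P => (p : Fin n → ℤ)) '' LogChart.unitFace P φ)) : ℕ) : WithBot ℕ∞))
    (hsing : ¬ IsRegularLocalRing R) :
    n - Module.finrank ℤ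
      (Submodule.span ℤ ((fun p : P => (p : Fin n → ℤ)) '' LogChart.unitFace P φ)) <
        (LogChart.nonunitIdeal P φ).spanFinrank := by
  refine lt_of_le_of_ne (rank_le_spanFinrank_nonunitIdeal P φ hreg hdim) fun h => hsing ?_
  exact (isRegularLocalRing_iff_spanFinrank_nonunitIdeal_eq P φ hreg hdim).mpr h.symm

/-- If at a full-rank point Kato's ideal is spanned by a finite set of at most `rank` elements of
`R`, the point is regular (the shape in which a FREE sharp stalk `P/F ≅ ℕʳ` is used: the images
of a basis). [cite: Kato1994, (10.4)] -/
theorem isRegularLocalRing_of_nonunitIdeal_eq_span_finset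
    (P : AddSubmonoid (Fin n → ℤ)) (φ : Multiplicative P →* R)
    (hreg : LogChart.IsLogRegularLocal P φ)
    (hdim : ringKrullDim R = ((n - Module.finrank ℤ
      (Submodule.span ℤ ((fun p : P => (p : Fin n → ℤ)) '' LogChart.unitFace P φ)) : ℕ) : WithBot ℕ∞))
    (S : Finset R) (hS : Ideal.span (S : Set R) = LogChart.nonunitIdeal P φ)
    (hcard : S.card ≤ n - Module.finrank ℤ
      (Submodule.span ℤ ((fun p : P => (p : Fin n → ℤ)) '' LogChart.unitFace P φ))) :
    IsRegularLocalRing R := by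
  refine (isRegularLocalRing_iff_spanFinrank_nonunitIdeal_eq P φ hreg hdim).mpr (le_antisymm ?_
    (rank_le_spanFinrank_nonunitIdeal P φ hreg hdim))
  rw [← hS]
  refine (Submodule.spanFinrank_span_le_ncard_of_finite S.finite_toSet).trans ?_
  rwa [Set.ncard_coe_finset]

end Local

/-! ## The `A_𝔭` forms (`LogChart.IsLogRegularAt`) -/

section Localization

variable {n : ℕ} {A : Type u} [CommRing A] [IsNoetherianRing A]

/-- **`A_𝔭` form of the regularity test at a full-rank point**: if `(A, φ)` is log regular at `𝔭`
with `dim A_𝔭 = r := n − rk F_𝔭ᵍᵖ`, then `A_𝔭` is regular iff `I(𝔭)·A_𝔭` is generated by `r`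
elements. [cite: Kato1994, Def. (2.1) and (10.4)] -/
theorem isRegularLocalRing_localization_iff_spanFinrank_eq
    (P : AddSubmonoid (Fin n → ℤ)) (φ : Multiplicative P →* A) (𝔭 : Ideal A) [𝔭.IsPrime]
    (hreg : LogChart.IsLogRegularAt P φ 𝔭)
    (hdim : ringKrullDim (Localization.AtPrime 𝔭) = ((n - Module.finrank ℤ
      (Submodule.span ℤ ((fun p : P => (p : Fin n → ℤ)) '' LogChart.face P φ 𝔭)) : ℕ) : WithBot ℕ∞)) :
    IsRegularLocalRing (Localization.AtPrime 𝔭) ↔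
      ((LogChart.ideal P φ 𝔭).map (algebraMap A (Localization.AtPrime 𝔭))).spanFinrank =
        n - Module.finrank ℤ
          (Submodule.span ℤ ((fun p : P => (p : Fin n → ℤ)) '' LogChart.face P φ 𝔭)) := by
  haveI : IsNoetherianRing (Localization.AtPrime 𝔭) :=
    IsLocalization.isNoetherianRing 𝔭.primeCompl _ inferInstance
  rw [LogClosedStratumPoint.ideal_map_eq_maximalIdeal_of_ringKrullDim_eq_rank P φ 𝔭 hreg hdim]
  exact isRegularLocalRing_iff_spanFinrank_eq (R := Localization.AtPrime 𝔭) hdim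

/-- `A_𝔭` form: at a full-rank point `I(𝔭)·A_𝔭` needs at least `rank` generators, and strictly
more if `A_𝔭` is singular. [cite: Kato1994, Def. (2.1)] -/
theorem rank_lt_spanFinrank_ideal_map_of_not_isRegularLocalRing
    (P : AddSubmonoid (Fin n → ℤ)) (φ : Multiplicative P →* A) (𝔭 : Ideal A) [𝔭.IsPrime]
    (hreg : LogChart.IsLogRegularAt P φ 𝔭)
    (hdim : ringKrullDim (Localization.AtPrime 𝔭) = ((n - Module.finrank ℤ
      (Submodule.span ℤ ((fun p : P => (p : Fin n → ℤ)) '' LogChart.face P φ 𝔭)) : ℕ) : WithBot ℕ∞))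
    (hsing : ¬ IsRegularLocalRing (Localization.AtPrime 𝔭)) :
    n - Module.finrank ℤ
      (Submodule.span ℤ ((fun p : P => (p : Fin n → ℤ)) '' LogChart.face P φ 𝔭)) <
        ((LogChart.ideal P φ 𝔭).map (algebraMap A (Localization.AtPrime 𝔭))).spanFinrank := by
  haveI : IsNoetherianRing (Localization.AtPrime 𝔭) :=
    IsLocalization.isNoetherianRing 𝔭.primeCompl _ inferInstance
  have hle : (n - Module.finrank ℤ
      (Submodule.span ℤ ((fun p : P => (p : Fin n → ℤ)) '' LogChart.face P φ 𝔭)) : ℕ) ≤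
        ((LogChart.ideal P φ 𝔭).map (algebraMap A (Localization.AtPrime 𝔭))).spanFinrank := by
    rw [LogClosedStratumPoint.ideal_map_eq_maximalIdeal_of_ringKrullDim_eq_rank P φ 𝔭 hreg hdim]
    exact le_spanFinrank_maximalIdeal_of_ringKrullDim_eq hdim
  refine lt_of_le_of_ne hle fun h => hsing ?_
  exact (isRegularLocalRing_localization_iff_spanFinrank_eq P φ 𝔭 hreg hdim).mpr h.symm

end Localization

end Summit.ResolutionOfSingularities.ResolutionOfSingularities.Theorems.FRationalResolution.LogClosedStratumPointRegular

end
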